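import Mathlib
import Summits.NavierStokesRegularity.NavierStokesRegularity.Theorems.LerayQuarterDissipationFiniteDissipationLiouvilleWindowBlobJets
import Summits.NavierStokesRegularity.NavierStokesRegularity.Theorems.LerayQuarterDissipationFiniteDissipationLiouvilleWindowRecurrenceProduction
import HarnessLib

/-!
# Crux `FiniteDissipationLiouville` (stmt-NavierStokesRegularity-22144): THE STRETCHING EXCESS AND THE
# SUPER-CALORIC SET (WITH EXTRA PALINSTROPHY CREDIT) FILL PARABOLIC CYLINDERS IN EVERY WINDOW

Theorems file of route `LerayQuarterDissipation` (lead prover g19; `--supports` the crux; second instance file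
of `…WindowBlobSocket`, after `…WindowBlobJets`). Navier–Stokes regularity is NOT proved by anything here; no
summit is.

* `stretching_ball`, **`stretching_excess_blob_in_every_window`** — for every `A` there are `ε(A) ∈ (0,1)`,
  `ρ(A) > 0` such that every singular KNSS-gauge Type-I field (`C ≤ A`) with a Type-I envelope
  `HasTypeIDecay A V` contains, in EVERY window `[−c², −εc²]`, a parabolic cylinder
  `[t₀ − (ρc)², t₀] × B(x₀, ρc)` on which vortex stretching beats local palinstrophy plus the scaling
  quarter, `|∇ω|²_F + ‖ω‖²/(4(−t)) < ⟪ω, ∇u ω⟫`;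
* `critProd_credit_ball`, **`superCaloric_credit_blob_in_every_window`** — THE CRUX FRAME (Type-I + LAW, no
  envelope): for all `C, K` there are `ε ∈ (0,1)`, `ρ > 0` and an EXTRA CREDIT `δ > 0` such that every
  SINGULAR member of `𝒟_{C,K}` contains, in every window, a parabolic cylinder of relative size `ρ` on which
  `‖ω‖² + (1+δ)(−t)|∇ω|²_F < (−t)⟪ω, ∇u ω⟫` — production beats the critical rate plus `(1+δ)×` the local
  palinstrophy on a coherent blob (in particular `t²‖ω‖²` is strictly super-caloric there).

Mechanism: the blob socket with the ball transfer supplied by the continuous convergence of the 2-jet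
(`…WindowBlobJets.jet_tendsto_prod`, from `…Compactness.seqLimit₂`).

HONEST FRAMING. Compactness corollaries (ineffective `ε, ρ, δ`) about a HYPOTHETICAL singular profile;
nothing is removed from the DSS wall (`∀ c>1 TypeIDSSLiouville c`, NECESSARY for the crux). Nothing here
bears on NS regularity.

References: Koch–Nadirashvili–Seregin–Šverák, Acta Math. 203 (2009) §4; folklore.
-/

noncomputable section

set_option linter.dupNamespace false

namespace Summit.NavierStokesRegularity.NavierStokesRegularity.Theorems.FiniteDissipationLiouville.WindowRecurrence

open MeasureTheory Set Filter Topology Metric InnerProductSpace Function Real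
open scoped RealInnerProductSpace ContDiff ENNReal
open Literature.Analysis Literature.Analysis.FluidPDE
open Summit.NavierStokesRegularity.NavierStokesRegularity.Theorems
open Summit.NavierStokesRegularity.NavierStokesRegularity.Theorems.RecurrentReductionD
open Summit.NavierStokesRegularity.NavierStokesRegularity.Theorems.FiniteDissipationLiouville
open Summit.NavierStokesRegularity.NavierStokesRegularity.Theorems.FiniteDissipationLiouville.CrossFlow
open Summit.NavierStokesRegularity.NavierStokesRegularity.Theorems.FiniteDissipationLiouville.LocalBalance
open Summit.NavierStokesRegularity.NavierStokesRegularity.Theorems.FiniteDissipationLiouville.CriticalProduction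
open Summit.NavierStokesRegularity.NavierStokesRegularity.Theorems.FiniteDissipationLiouville.WindowSocket
open Summit.NavierStokesRegularity.NavierStokesRegularity.Theorems.FiniteDissipationLiouville.Compactness

variable {C : ℝ}

/-- Joint continuity of evaluation along a filter: `L_q → L`, `b_q → b` give `L_q b_q → L b`. [folklore] -/
theorem tendsto_clm_apply_filter {ι : Type*} {l : Filter ι}
    {L : ι → (EuclideanSpace ℝ (Fin 3) →L[ℝ] EuclideanSpace ℝ (Fin 3))}
    {L₀ : EuclideanSpace ℝ (Fin 3) →L[ℝ] EuclideanSpace ℝ (Fin 3)}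
    {b : ι → EuclideanSpace ℝ (Fin 3)} {b₀ : EuclideanSpace ℝ (Fin 3)}
    (hL : Tendsto L l (𝓝 L₀)) (hb : Tendsto b l (𝓝 b₀)) :
    Tendsto (fun j => L j (b j)) l (𝓝 (L₀ b₀)) := by
  have hc : Continuous fun p : (EuclideanSpace ℝ (Fin 3) →L[ℝ] EuclideanSpace ℝ (Fin 3)) ×
      EuclideanSpace ℝ (Fin 3) => p.1 p.2 := isBoundedBilinearMap_apply.continuous
  exact (hc.tendsto (L₀, b₀)).comp (hL.prodMk_nhds hb)

/-! ### The stretching-form balance -/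

section Stretching

/-- **Ball transfer for the stretching-form balance.** [cite: KochNadirashviliSereginSverak2009, Prop. 4.1 (arXiv:0709.3599 p. 8)] -/
theorem stretching_ball {v : ℕ → ℝ → EuclideanSpace ℝ (Fin 3) → EuclideanSpace ℝ (Fin 3)}
    {W : ℝ → EuclideanSpace ℝ (Fin 3) → EuclideanSpace ℝ (Fin 3)}
    (hv : ∀ j, IsTypeIAncientMild C (v j)) (hW : IsTypeIAncientMild C W)
    (hunif : ∀ n : ℕ, TendstoUniformlyOn (fun j z => v j z.1 z.2) (fun z => W z.1 z.2) atTop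
      (Icc (-((n : ℝ) + 2)) (-(1 / ((n : ℝ) + 2))) ×ˢ
        closedBall (0 : EuclideanSpace ℝ (Fin 3)) ((n : ℝ) + 2)))
    (hunifG : ∀ n : ℕ, TendstoUniformlyOn (fun j z => fderiv ℝ (v j z.1) z.2) (fun z => fderiv ℝ (W z.1) z.2)
      atTop (Icc (-((n : ℝ) + 2)) (-(1 / ((n : ℝ) + 2))) ×ˢ
        closedBall (0 : EuclideanSpace ℝ (Fin 3)) ((n : ℝ) + 2)))
    (hunifH : ∀ n : ℕ, TendstoUniformlyOn (fun j z => fderiv ℝ (fderiv ℝ (v j z.1)) z.2)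
      (fun z => fderiv ℝ (fderiv ℝ (W z.1)) z.2)
      atTop (Icc (-((n : ℝ) + 2)) (-(1 / ((n : ℝ) + 2))) ×ˢ
        closedBall (0 : EuclideanSpace ℝ (Fin 3)) ((n : ℝ) + 2)))
    {t₀ : ℝ} (ht₀ : t₀ < 0) (x₀ : EuclideanSpace ℝ (Fin 3))
    (hbad : ¬ ⟪curl (W t₀) x₀, fderiv ℝ (W t₀) x₀ (curl (W t₀) x₀)⟫ ≤
      frobeniusNormSq (fderiv ℝ (curl (W t₀)) x₀) + ‖curl (W t₀) x₀‖ ^ 2 / (4 * (-t₀))) :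
    ∃ r : ℝ, 0 < r ∧ ∀ᶠ j in atTop, ∀ q : ℝ × EuclideanSpace ℝ (Fin 3), dist q (t₀, x₀) < r →
      ¬ ⟪curl (v j q.1) q.2, fderiv ℝ (v j q.1) q.2 (curl (v j q.1) q.2)⟫ ≤
        frobeniusNormSq (fderiv ℝ (curl (v j q.1)) q.2) + ‖curl (v j q.1) q.2‖ ^ 2 / (4 * (-q.1)) := by
  obtain ⟨s, hs, hT, -, h1, -, h3, h4⟩ := jet_tendsto_prod hv hW hunif hunifG hunifH ht₀ x₀
  have hLb := tendsto_clm_apply_filter h3 h1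
  have hL : Tendsto (fun q : ℕ × (ℝ × EuclideanSpace ℝ (Fin 3)) =>
      ⟪curl (v q.1 q.2.1) q.2.2, fderiv ℝ (v q.1 q.2.1) q.2.2 (curl (v q.1 q.2.1) q.2.2)⟫)
      (atTop ×ˢ 𝓝[s] (t₀, x₀)) (𝓝 ⟪curl (W t₀) x₀, fderiv ℝ (W t₀) x₀ (curl (W t₀) x₀)⟫) := h1.inner hLb
  have hden : Tendsto (fun q : ℕ × (ℝ × EuclideanSpace ℝ (Fin 3)) => 4 * (-q.2.1))
      (atTop ×ˢ 𝓝[s] (t₀, x₀)) (𝓝 (4 * (-t₀))) := (hT.neg).const_mul 4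
  have hden0 : (4 : ℝ) * (-t₀) ≠ 0 := by
    have : 0 < -t₀ := neg_pos.2 ht₀
    positivity
  have hR : Tendsto (fun q : ℕ × (ℝ × EuclideanSpace ℝ (Fin 3)) =>
      frobeniusNormSq (fderiv ℝ (curl (v q.1 q.2.1)) q.2.2) + ‖curl (v q.1 q.2.1) q.2.2‖ ^ 2 / (4 * (-q.2.1)))
      (atTop ×ˢ 𝓝[s] (t₀, x₀))
      (𝓝 (frobeniusNormSq (fderiv ℝ (curl (W t₀)) x₀) + ‖curl (W t₀) x₀‖ ^ 2 / (4 * (-t₀)))) :=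
    ((continuous_frobeniusNormSq'.tendsto _).comp h4).add ((h1.norm.pow 2).div hden hden0)
  rw [not_le] at hbad
  have hev := hR.eventually_lt hL hbad
  obtain ⟨r, hr, hball⟩ := exists_ball_eventually_of_prod_nhds hs hev
  exact ⟨r, hr, hball.mono fun j hj q hq => not_le.2 (hj q hq)⟩

/-- **THE VORTEX-STRETCHING EXCESS FILLS A PARABOLIC CYLINDER OF DEFINITE RELATIVE SIZE IN EVERY WINDOW.**
[folklore compactness; cite: KochNadirashviliSereginSverak2009, §4 (arXiv:0709.3599 p. 8)] -/
theorem stretching_excess_blob_in_every_window (A : ℝ) : ∃ ε : ℝ, 0 < ε ∧ ε < 1 ∧ ∃ ρ : ℝ, 0 < ρ ∧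
    ∀ (C : ℝ) (V : ℝ → EuclideanSpace ℝ (Fin 3) → EuclideanSpace ℝ (Fin 3)),
      IsTypeIAncientMild C V → C ≤ A → HasTypeIDecay A V →
      (∀ r > 0, ∀ M : ℝ, ∃ t ∈ Ioo (-(r ^ 2)) (0 : ℝ),
        ∃ x ∈ ball (0 : EuclideanSpace ℝ (Fin 3)) r, M < ‖V t x‖) →
      ∀ c : ℝ, 0 < c → ∃ (t₀ : ℝ) (x₀ : EuclideanSpace ℝ (Fin 3)),
        Icc (t₀ - (ρ * c) ^ 2) t₀ ⊆ Icc (-c ^ 2) (-(ε * c ^ 2)) ∧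
        ∀ t ∈ Icc (t₀ - (ρ * c) ^ 2) t₀, ∀ x ∈ ball x₀ (ρ * c),
          frobeniusNormSq (fderiv ℝ (curl (V t)) x) + ‖curl (V t) x‖ ^ 2 / (4 * (-t)) <
            ⟪curl (V t) x, fderiv ℝ (V t) x (curl (V t) x)⟫ := by
  -- the blob socket with the constant family `G θ := balance` (no margin is claimed here)
  obtain ⟨ε, hε, hε1, ρ, hρ, δ, -, h⟩ := exists_blob_margin_of_apex_kill_envelope (C := A) (θ₀ := 1)
    (G := fun _ F t x => ⟪curl (F t) x, fderiv ℝ (F t) x (curl (F t) x)⟫ ≤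
      frobeniusNormSq (fderiv ℝ (curl (F t)) x) + ‖curl (F t) x‖ ^ 2 / (4 * (-t)))
    (fun u W θ hu hW hunif hunifG hunifH _ t₀ ht₀ x₀ hbad =>
      stretching_ball hu hW hunif hunifG hunifH ht₀ x₀ hbad)
    (fun W hW hdW hG => not_singular_of_stretchingBalance_near_apex hW hdW (τ := -1/2) (by norm_num)
      fun t h1 h2 x => hG t (by linarith) h2 x)
  refine ⟨ε, hε, hε1, ρ, hρ, fun C V hV hCA hdec hsing c hc => ?_⟩
  obtain ⟨t₀, x₀, hwin, hblob⟩ := h (nsRescale c V) ((isTypeIAncientMild_of_le hV hCA).nsRescale hc)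
    (hdec.nsRescale hc) (singularAtOrigin_nsRescale hsing hc)
  obtain ⟨hwin', hblob'⟩ := blob_rescale (θ := 1 + δ) (ε := ε) (ρ := ρ) (c := c)
    (G := fun _ F t x => ⟪curl (F t) x, fderiv ℝ (F t) x (curl (F t) x)⟫ ≤
      frobeniusNormSq (fderiv ℝ (curl (F t)) x) + ‖curl (F t) x‖ ^ 2 / (4 * (-t)))
    (fun F c' t x hc' ht hG => stretchingBalance_at_nsRescale F x hc' ht hG) hc hε hwin hblob
  exact ⟨c ^ 2 * t₀, c • x₀, hwin', fun t ht x hx => not_le.1 (hblob' t ht x hx)⟩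

end Stretching

/-! ### The super-caloric set with an extra palinstrophy credit (crux frame) -/

section SuperCaloric

/-- **Ball transfer for the critical-production bound with credits `θ_j → 1`.**
[cite: KochNadirashviliSereginSverak2009, Prop. 4.1 (arXiv:0709.3599 p. 8)] -/
theorem critProd_credit_ball {v : ℕ → ℝ → EuclideanSpace ℝ (Fin 3) → EuclideanSpace ℝ (Fin 3)}
    {W : ℝ → EuclideanSpace ℝ (Fin 3) → EuclideanSpace ℝ (Fin 3)} {θ : ℕ → ℝ}
    (hv : ∀ j, IsTypeIAncientMild C (v j)) (hW : IsTypeIAncientMild C W)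
    (hunif : ∀ n : ℕ, TendstoUniformlyOn (fun j z => v j z.1 z.2) (fun z => W z.1 z.2) atTop
      (Icc (-((n : ℝ) + 2)) (-(1 / ((n : ℝ) + 2))) ×ˢ
        closedBall (0 : EuclideanSpace ℝ (Fin 3)) ((n : ℝ) + 2)))
    (hunifG : ∀ n : ℕ, TendstoUniformlyOn (fun j z => fderiv ℝ (v j z.1) z.2) (fun z => fderiv ℝ (W z.1) z.2)
      atTop (Icc (-((n : ℝ) + 2)) (-(1 / ((n : ℝ) + 2))) ×ˢ
        closedBall (0 : EuclideanSpace ℝ (Fin 3)) ((n : ℝ) + 2)))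
    (hunifH : ∀ n : ℕ, TendstoUniformlyOn (fun j z => fderiv ℝ (fderiv ℝ (v j z.1)) z.2)
      (fun z => fderiv ℝ (fderiv ℝ (W z.1)) z.2)
      atTop (Icc (-((n : ℝ) + 2)) (-(1 / ((n : ℝ) + 2))) ×ˢ
        closedBall (0 : EuclideanSpace ℝ (Fin 3)) ((n : ℝ) + 2)))
    (hθ : Tendsto θ atTop (𝓝 1)) {t₀ : ℝ} (ht₀ : t₀ < 0) (x₀ : EuclideanSpace ℝ (Fin 3))
    (hbad : ¬ (-t₀) * (⟪curl (W t₀) x₀, fderiv ℝ (W t₀) x₀ (curl (W t₀) x₀)⟫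
        - 1 * frobeniusNormSq (fderiv ℝ (curl (W t₀)) x₀)) ≤ ⟪curl (W t₀) x₀, curl (W t₀) x₀⟫) :
    ∃ r : ℝ, 0 < r ∧ ∀ᶠ j in atTop, ∀ q : ℝ × EuclideanSpace ℝ (Fin 3), dist q (t₀, x₀) < r →
      ¬ (-q.1) * (⟪curl (v j q.1) q.2, fderiv ℝ (v j q.1) q.2 (curl (v j q.1) q.2)⟫
          - θ j * frobeniusNormSq (fderiv ℝ (curl (v j q.1)) q.2)) ≤ ⟪curl (v j q.1) q.2, curl (v j q.1) q.2⟫ := by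
  obtain ⟨s, hs, hT, -, h1, -, h3, h4⟩ := jet_tendsto_prod hv hW hunif hunifG hunifH ht₀ x₀
  have hLb := tendsto_clm_apply_filter h3 h1
  have hθ' : Tendsto (fun q : ℕ × (ℝ × EuclideanSpace ℝ (Fin 3)) => θ q.1) (atTop ×ˢ 𝓝[s] (t₀, x₀)) (𝓝 1) :=
    hθ.comp tendsto_fst
  have hL : Tendsto (fun q : ℕ × (ℝ × EuclideanSpace ℝ (Fin 3)) =>
      (-q.2.1) * (⟪curl (v q.1 q.2.1) q.2.2, fderiv ℝ (v q.1 q.2.1) q.2.2 (curl (v q.1 q.2.1) q.2.2)⟫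
        - θ q.1 * frobeniusNormSq (fderiv ℝ (curl (v q.1 q.2.1)) q.2.2)))
      (atTop ×ˢ 𝓝[s] (t₀, x₀))
      (𝓝 ((-t₀) * (⟪curl (W t₀) x₀, fderiv ℝ (W t₀) x₀ (curl (W t₀) x₀)⟫
        - 1 * frobeniusNormSq (fderiv ℝ (curl (W t₀)) x₀)))) :=
    hT.neg.mul ((h1.inner hLb).sub (hθ'.mul ((continuous_frobeniusNormSq'.tendsto _).comp h4)))
  have hR : Tendsto (fun q : ℕ × (ℝ × EuclideanSpace ℝ (Fin 3)) =>
      ⟪curl (v q.1 q.2.1) q.2.2, curl (v q.1 q.2.1) q.2.2⟫) (atTop ×ˢ 𝓝[s] (t₀, x₀))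
      (𝓝 ⟪curl (W t₀) x₀, curl (W t₀) x₀⟫) := h1.inner h1
  rw [not_le] at hbad
  have hev := hR.eventually_lt hL hbad
  obtain ⟨r, hr, hball⟩ := exists_ball_eventually_of_prod_nhds hs hev
  exact ⟨r, hr, hball.mono fun j hj q hq => not_le.2 (hj q hq)⟩

/-- **THE SUPER-CALORIC SET WITH AN EXTRA PALINSTROPHY CREDIT FILLS A PARABOLIC CYLINDER IN EVERY WINDOW
(crux frame).** For all `C, K` there are `ε ∈ (0,1)`, `ρ > 0`, `δ > 0` such that every singular member
of `𝒟_{C,K}` contains, in every window `[−c², −εc²]`, a cylinder `[t₀ − (ρc)², t₀] × B(x₀, ρc)` on which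
`‖ω‖² < (−t)(⟪ω, ∇u ω⟫ − (1+δ)|∇ω|²_F)`. [parabolic strong maximum principle + KNSS compactness;
cite: KochNadirashviliSereginSverak2009, §4 (arXiv:0709.3599 p. 8)] -/
theorem superCaloric_credit_blob_in_every_window (C K : ℝ) : ∃ ε : ℝ, 0 < ε ∧ ε < 1 ∧ ∃ ρ : ℝ, 0 < ρ ∧
    ∃ δ : ℝ, 0 < δ ∧
    ∀ (V : ℝ → EuclideanSpace ℝ (Fin 3) → EuclideanSpace ℝ (Fin 3)), IsTypeIAncientMild C V →
      (∀ s : ℝ, s < 0 → ∫⁻ x, ‖fderiv ℝ (V s) x‖ₑ ^ 2 ≤ ENNReal.ofReal (K / Real.sqrt (-s))) →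
      (∀ r > 0, ∀ M : ℝ, ∃ t ∈ Ioo (-(r ^ 2)) (0 : ℝ),
        ∃ x ∈ ball (0 : EuclideanSpace ℝ (Fin 3)) r, M < ‖V t x‖) →
      ∀ c : ℝ, 0 < c → ∃ (t₀ : ℝ) (x₀ : EuclideanSpace ℝ (Fin 3)),
        Icc (t₀ - (ρ * c) ^ 2) t₀ ⊆ Icc (-c ^ 2) (-(ε * c ^ 2)) ∧
        ∀ t ∈ Icc (t₀ - (ρ * c) ^ 2) t₀, ∀ x ∈ ball x₀ (ρ * c),
          ⟪curl (V t) x, curl (V t) x⟫ < (-t) * (⟪curl (V t) x, fderiv ℝ (V t) x (curl (V t) x)⟫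
            - (1 + δ) * frobeniusNormSq (fderiv ℝ (curl (V t)) x)) := by
  obtain ⟨ε, hε, hε1, ρ, hρ, δ, hδ, h⟩ := exists_blob_margin_of_apex_kill (C := C) (K := K) (θ₀ := 1)
    (Q := fun _ => True)
    (G := fun θ F s y => (-s) * (⟪curl (F s) y, fderiv ℝ (F s) y (curl (F s) y)⟫
        - θ * frobeniusNormSq (fderiv ℝ (curl (F s)) y)) ≤ ⟪curl (F s) y, curl (F s) y⟫)
    (fun _ _ _ _ _ _ => trivial)
    (fun u W θ hu hW hunif hunifG hunifH hθ t₀ ht₀ x₀ hbad =>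
      critProd_credit_ball hu hW hunif hunifG hunifH hθ ht₀ x₀ hbad)
    (fun W hW hlawW _ hG => not_singular_of_enstrophy_subsolution_near_apex hW hlawW (τ := -1/2)
      (by norm_num) fun s h1 h2 y => by
        have := hG s (by linarith) h2 y
        rwa [one_mul] at this)
  refine ⟨ε, hε, hε1, ρ, hρ, δ, hδ, fun V hV hlaw hsing c hc => ?_⟩
  obtain ⟨t₀, x₀, hwin, hblob⟩ := h (nsRescale c V) (hV.nsRescale hc) (dissipationLaw_nsRescale hlaw hc)
    trivial (singularAtOrigin_nsRescale hsing hc)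
  obtain ⟨hwin', hblob'⟩ := blob_rescale (θ := 1 + δ) (ε := ε) (ρ := ρ) (c := c)
    (G := fun θ F s y => (-s) * (⟪curl (F s) y, fderiv ℝ (F s) y (curl (F s) y)⟫
        - θ * frobeniusNormSq (fderiv ℝ (curl (F s)) y)) ≤ ⟪curl (F s) y, curl (F s) y⟫)
    (fun F c' s y hc' _ hG => critProd_at_nsRescale F (1 + δ) y hc' hG) hc hε hwin hblob
  exact ⟨c ^ 2 * t₀, c • x₀, hwin', fun t ht x hx => not_le.1 (hblob' t ht x hx)⟩

end SuperCaloric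

end Summit.NavierStokesRegularity.NavierStokesRegularity.Theorems.FiniteDissipationLiouville.WindowRecurrence

end
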